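import Literature.Probability.RandomPlanarGeometry.LoewnerImageClock
import HarnessLib

/-!
# The conformal image of a Loewner chain is a Loewner chain: the image flow in capacity time solves Loewner's equation driven by `W̃ ∘ σ⁻¹`

[LSW] 2003 §5: "`g̃_t := h_t ∘ g_t ∘ Φ_A⁻¹` … after the time change by the capacity … the maps `g̃`
satisfy the Loewner equation with driving function `W̃`"; G. F. Lawler (2005), §4.6.1, Prop. 4.41:
"`K*_{σ(t)}`, `t < T`, is a Loewner chain with driving function `U*_t = Φ_{σ(t)}(U_{σ(t)})`". With
the capacity clock `σ = imageClock W A` and its inverse `τ = imageClockInv W A β` on `[0, σ β]`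
(`LoewnerImageClock`), for an alive time `β` and a point `z ∈ ℍ ∖ A` alive at `β`, we PROVE:

* `imageDriverC W A β` — the **image driving function in capacity time** `q ↦ W̃_{τ q}` (frozen after
  `σ β`), continuous (`continuous_imageDriverC`);
* `imageFlowC W A β z` — the **image flow in capacity time** `q ↦ g̃_{τ q}(ζ)`, `ζ = Φ_A(z)`;
* `hasDerivAt_imageFlowC` — **`∂_q g̃_{τ q}(ζ) = 2/(g̃_{τ q}(ζ) − W̃_{τ q})` on `(0, σ β)`**
  (chain rule: (5.1) `hasDerivAt_imageFlow` times `τ' = 1/d²`, `hasDerivAt_imageClockInv`), and the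
  right derivative at `q = 0` (`hasDerivWithinAt_imageFlowC_zero`, by extension of the derivative);
* **`isSolution_imageFlowC`** — hence `q ↦ g̃_{τ q}(ζ)` is a solution of the tree's chordal Loewner
  equation `Loewner.IsSolution` driven by `W̃ ∘ τ`, started at `g̃_0(ζ)`, with lifetime `σ β`, and
* **`map_imageDriverC_eq`** — `Loewner.map (W̃ ∘ τ) q (g̃_0 ζ) = g̃_{τ q}(ζ)` for `q < σ β`: **the
  image maps ARE the Loewner maps of the image driving function in capacity time** (for `W 0 = 0`,
  `g̃_0 = Φ_A = E_A` on `ℍ ∖ A`, `imageFlow_zero`).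

What is NOT here: the identification of the hulls (`Loewner.hull (W̃ ∘ τ) q = E_A(K_{τ q} ∖ A)`,
through the lifetime correspondence) and of the generating curve (`E_A ∘ γ ∘ τ`), needed to read
the image curve class as driven by `W̃ ∘ τ`. No named fact; two definitions with bodies.

## References

* [LSW] 2003, §5 (g̃, W̃, (5.1)). [LawlerSchrammWerner2003Restriction]
* G. F. Lawler (2005), §4.6.1 Prop. 4.40–4.41. [Lawler2005]
-/

noncomputable section

open Set Filter Metric Function MeasureTheory intervalIntegral
open _root_.Complex _root_.Topology _root_.Real
open scoped NNReal

namespace Literature.Probability.RandomPlanarGeometry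

namespace Loewner

variable {W : ℝ≥0 → ℝ} {A : Set ℂ}

/-! ### The image driving function and the image flow in capacity time -/

/-- **The image driving function in capacity time**: `q ↦ W̃_{τ(q ∧ σβ)}` (`τ = imageClockInv W A β`;
frozen after the image lifetime horizon `σ β`). [cite: LawlerSchrammWerner2003Restriction, §5 (W̃ after the time change)] -/
def imageDriverC (W : ℝ≥0 → ℝ) (A : Set ℂ) (β : ℝ≥0) (q : ℝ≥0) : ℝ :=
  imageDriver W A (imageClockInv W A β (min (q : ℝ) (imageClock W A β))).toNNReal

/-- **The image flow of a point in capacity time**: `q ↦ g̃_{τ q}(ζ)`, `ζ = Φ_A(z)`.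
[cite: LawlerSchrammWerner2003Restriction, §5 (g̃ after the time change)] -/
def imageFlowC (W : ℝ≥0 → ℝ) (A : Set ℂ) (β : ℝ≥0) (z : ℂ) (q : ℝ) : ℂ :=
  imageFlow W A (imageClockInv W A β q).toNNReal z

section Chain

variable (hW : Continuous W) (hA : IsStarHull A) (hne : A.Nonempty) {β : ℝ≥0}
  (hβ : Disjoint (closedHull W β) A)

include hW hA hne hβ in
/-- **`q ↦ W̃_{τ q}` is continuous** (`W̃ ∘ toNNReal` is continuous on `[0, β]`, `τ` on `[0, σβ]`, and the
clamp `q ↦ q ∧ σβ` is continuous into `[0, σβ]`). [folklore] -/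
theorem continuous_imageDriverC : Continuous (imageDriverC W A β) := by
  have hτ := continuousOn_imageClockInv hW hA hne hβ
  have hWt : ContinuousOn (fun t : ℝ ↦ imageDriver W A t.toNNReal) (Icc (0 : ℝ) β) := fun t ht ↦
    continuousWithinAt_comp_toNNReal hβ t
      (continuousWithinAt_imageDriver hW hA hne
        (alive_mono (by rw [← NNReal.coe_le_coe, Real.coe_toNNReal _ ht.1]; exact ht.2) hβ))
  have hcomp : ContinuousOn (fun q : ℝ ↦ imageDriver W A (imageClockInv W A β q).toNNReal)
      (Icc (0 : ℝ) (imageClock W A β)) :=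
    hWt.comp hτ fun q hq ↦ (imageClockInv_spec hW hA hne hβ hq).1
  have hclamp : Continuous fun q : ℝ≥0 ↦ min (q : ℝ) (imageClock W A β) :=
    NNReal.continuous_coe.min continuous_const
  have hS0 : 0 ≤ imageClock W A β := (imageClock_mem hW hA hne hβ ⟨β.coe_nonneg, le_rfl⟩).1
  exact hcomp.comp_continuous hclamp fun q ↦ ⟨le_min q.coe_nonneg hS0, min_le_right _ _⟩

/-- On `[0, σβ]` the clamp is inactive: `imageDriverC q.toNNReal = W̃_{τ q}`. [folklore] -/
theorem imageDriverC_toNNReal {β : ℝ≥0} {q : ℝ} (hq : q ∈ Icc (0 : ℝ) (imageClock W A β)) :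
    imageDriverC W A β q.toNNReal = imageDriver W A (imageClockInv W A β q).toNNReal := by
  rw [imageDriverC, Real.coe_toNNReal q hq.1, min_eq_left hq.2]

variable {z : ℂ} (hzH : 0 < z.im) (hzA : z ∉ A) (hzβ : (β : WithTop ℝ≥0) < swallowingTime W z)

include hW hA hne hβ in
/-- `imageFlowC` at `q = 0` is `g̃_0(ζ)`. [folklore] -/
theorem imageFlowC_zero : imageFlowC W A β z 0 = imageFlow W A 0 z := by
  rw [imageFlowC, imageClockInv_zero hW hA hne hβ, Real.toNNReal_zero]

include hW hA hne hβ hzH hzA hzβ in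
/-- **`∂_q g̃_{τ q}(ζ) = 2/(g̃_{τ q}(ζ) − W̃_{τ q})` on `(0, σβ)`** (chain rule: (5.1) at `s = τ q ∈ (0, β)`
times `τ'(q) = (d_{τ q}²)⁻¹`). [cite: LawlerSchrammWerner2003Restriction, §5 (5.1) after the time change; Lawler2005, Prop. 4.41] -/
theorem hasDerivAt_imageFlowC {q : ℝ} (hq : q ∈ Ioo (0 : ℝ) (imageClock W A β)) :
    HasDerivAt (imageFlowC W A β z)
      (2 / (imageFlowC W A β z q - imageDriver W A (imageClockInv W A β q).toNNReal)) q := by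
  have hτI := imageClockInv_mem_Ioo hW hA hne hβ hq
  set s : ℝ := imageClockInv W A β q with hs
  have hτ' := hasDerivAt_imageClockInv hW hA hne hβ hq
  have hG := hasDerivAt_imageFlow hW hA hne hβ hzH hzA hzβ hτI.1 hτI.2
  have h := hG.scomp q hτ'
  have hfun : (fun t : ℝ ↦ imageFlow W A t.toNNReal z) ∘ imageClockInv W A β = imageFlowC W A β z := rfl
  rw [hfun] at h
  refine h.congr_deriv ?_
  have hd : (starDeriv (slidHull W A s.toNNReal) : ℂ) ≠ 0 := ofReal_ne_zero.2 (starDeriv_pos_le_one _).1.ne'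
  simp only [imageClockRate, imageFlowC, ← hs, Complex.real_smul]
  push_cast
  field_simp

include hW hA hne hβ hzH hzA hzβ in
/-- Continuity of `q ↦ g̃_{τ q}(ζ)` and of `q ↦ W̃_{τ q}` within `[0, σβ]`. [folklore] -/
theorem continuousOn_imageFlowC :
    ContinuousOn (imageFlowC W A β z) (Icc (0 : ℝ) (imageClock W A β)) ∧
    ContinuousOn (fun q : ℝ ↦ (imageDriver W A (imageClockInv W A β q).toNNReal : ℂ)) (Icc (0 : ℝ) (imageClock W A β)) := by
  have hτ := continuousOn_imageClockInv hW hA hne hβ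
  have hle : ∀ {t : ℝ}, t ∈ Icc (0 : ℝ) β → t.toNNReal ≤ β := fun ht ↦ by
    rw [← NNReal.coe_le_coe, Real.coe_toNNReal _ ht.1]; exact ht.2
  have hG : ContinuousOn (fun t : ℝ ↦ imageFlow W A t.toNNReal z) (Icc (0 : ℝ) β) := fun t ht ↦
    continuousWithinAt_comp_toNNReal hβ t
      (continuousWithinAt_imageFlow hW hA hne (alive_mono (hle ht) hβ) hzH hzA
        (lt_of_le_of_lt (WithTop.coe_le_coe.2 (hle ht)) hzβ))
  have hWt : ContinuousOn (fun t : ℝ ↦ imageDriver W A t.toNNReal) (Icc (0 : ℝ) β) := fun t ht ↦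
    continuousWithinAt_comp_toNNReal hβ t (continuousWithinAt_imageDriver hW hA hne (alive_mono (hle ht) hβ))
  refine ⟨hG.comp hτ fun q hq ↦ (imageClockInv_spec hW hA hne hβ hq).1, ?_⟩
  exact Complex.continuous_ofReal.comp_continuousOn (hWt.comp hτ fun q hq ↦ (imageClockInv_spec hW hA hne hβ hq).1)

include hW hA hne hβ hzH hzA hzβ in
/-- `g̃_{τ q}(ζ) − W̃_{τ q} ∈ ℍ` for `q ∈ [0, σβ]`. [folklore] -/
theorem im_imageFlowC_sub_pos {q : ℝ} (hq : q ∈ Icc (0 : ℝ) (imageClock W A β)) :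
    0 < (imageFlowC W A β z q - imageDriver W A (imageClockInv W A β q).toNNReal).im := by
  have ht := (imageClockInv_spec hW hA hne hβ hq).1
  have hle : (imageClockInv W A β q).toNNReal ≤ β := by
    rw [← NNReal.coe_le_coe, Real.coe_toNNReal _ ht.1]; exact ht.2
  exact im_imageFlow_sub_imageDriver_pos hW hA (alive_mono hle hβ) hzH hzA
    (lt_of_le_of_lt (WithTop.coe_le_coe.2 hle) hzβ)

include hW hA hne hβ hzH hzA hzβ in
/-- **The right derivative at `q = 0`**: `2/(g̃_0(ζ) − W̃_0)` within `[0, ∞)` (`σβ > 0`), by extension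
of the interior derivative (`hasDerivWithinAt_Ici_of_tendsto_deriv`: the flow is continuous at `0⁺` and
its derivative `2/(g̃ − W̃)` has a limit there). [folklore] -/
theorem hasDerivWithinAt_imageFlowC_zero (hS : 0 < imageClock W A β) :
    HasDerivWithinAt (imageFlowC W A β z)
      (2 / (imageFlowC W A β z 0 - imageDriver W A (imageClockInv W A β 0).toNNReal)) (Ici (0 : ℝ)) 0 := by
  set S := imageClock W A β with hSdef
  obtain ⟨hGc, hWc⟩ := continuousOn_imageFlowC hW hA hne hβ hzH hzA hzβ
  set F : ℝ → ℂ := fun q ↦ 2 / (imageFlowC W A β z q - imageDriver W A (imageClockInv W A β q).toNNReal) with hF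
  have hFc : ContinuousOn F (Icc (0 : ℝ) S) := by
    refine continuousOn_const.div (hGc.sub hWc) fun q hq h0 ↦ ?_
    have := im_imageFlowC_sub_pos hW hA hne hβ hzH hzA hzβ hq
    rw [h0, zero_im] at this
    exact lt_irrefl _ this
  have hderiv : ∀ q ∈ Ioo (0 : ℝ) S, HasDerivAt (imageFlowC W A β z) (F q) q := fun q hq ↦
    hasDerivAt_imageFlowC hW hA hne hβ hzH hzA hzβ hq
  have hdiff : DifferentiableOn ℝ (imageFlowC W A β z) (Ioo (0 : ℝ) S) := fun q hq ↦
    (hderiv q hq).differentiableAt.differentiableWithinAt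
  have hmem : Ioo (0 : ℝ) S ∈ 𝓝[>] (0 : ℝ) := Ioo_mem_nhdsGT hS
  have hcont : ContinuousWithinAt (imageFlowC W A β z) (Ioo (0 : ℝ) S) 0 :=
    (hGc 0 ⟨le_rfl, hS.le⟩).mono Ioo_subset_Icc_self
  have hlim : Tendsto (fun q ↦ deriv (imageFlowC W A β z) q) (𝓝[>] (0 : ℝ)) (𝓝 (F 0)) := by
    have h1 : Tendsto F (𝓝[>] (0 : ℝ)) (𝓝 (F 0)) :=
      (hFc 0 ⟨le_rfl, hS.le⟩).tendsto.mono_left (by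
        rw [nhdsWithin_Icc_eq_nhdsGE hS]; exact nhdsWithin_mono _ Ioi_subset_Ici_self)
    refine h1.congr' ?_
    filter_upwards [hmem] with q hq
    exact ((hderiv q hq).deriv).symm
  exact hasDerivWithinAt_Ici_of_tendsto_deriv hdiff hcont hmem hlim

include hW hA hne hβ hzH hzA hzβ in
/-- **The image flow in capacity time solves Loewner's equation driven by `W̃ ∘ τ`** with lifetime
`σβ`: `Loewner.IsSolution (imageDriverC W A β) (g̃_0 ζ) (imageFlowC W A β z) (σβ)`.
[cite: LawlerSchrammWerner2003Restriction, §5 (g̃ is a Loewner chain); Lawler2005, Prop. 4.41] -/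
theorem isSolution_imageFlowC :
    IsSolution (imageDriverC W A β) (imageFlow W A 0 z) (imageFlowC W A β z)
      ((imageClock W A β).toNNReal : WithTop ℝ≥0) := by
  set S : ℝ := imageClock W A β with hSdef
  have hS0 : 0 ≤ S := (imageClock_mem hW hA hne hβ ⟨β.coe_nonneg, le_rfl⟩).1
  -- membership in the time set `{0 ≤ t ∧ t.toNNReal < S}` means `t ∈ [0, S)`
  have hset : ∀ {t : ℝ}, (0 ≤ t ∧ ((t.toNNReal : WithTop ℝ≥0) < (S.toNNReal : WithTop ℝ≥0))) ↔ t ∈ Ico (0 : ℝ) S := by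
    intro t
    constructor
    · rintro ⟨ht0, ht⟩
      refine ⟨ht0, ?_⟩
      have := WithTop.coe_lt_coe.1 ht
      rwa [← NNReal.coe_lt_coe, Real.coe_toNNReal t ht0, Real.coe_toNNReal S hS0] at this
    · rintro ⟨ht0, ht⟩
      refine ⟨ht0, WithTop.coe_lt_coe.2 ?_⟩
      rwa [← NNReal.coe_lt_coe, Real.coe_toNNReal t ht0, Real.coe_toNNReal S hS0]
  refine ⟨imageFlowC_zero hW hA hne hβ, fun t ht ↦ ?_, fun t ht0 htS ↦ ?_⟩
  · have htI := hset.1 ht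
    have hvf : vectorField (imageDriverC W A β) t (imageFlowC W A β z t) =
        2 / (imageFlowC W A β z t - imageDriver W A (imageClockInv W A β t).toNNReal) := by
      rw [vectorField_apply, imageDriverC_toNNReal ⟨htI.1, htI.2.le⟩]
    rw [hvf]
    rcases htI.1.eq_or_lt with h0 | hpos
    · -- `t = 0`: the right derivative, restricted to the time set
      have hS : 0 < S := by have := htI.2; rwa [← h0] at this
      rw [← h0]
      exact (hasDerivWithinAt_imageFlowC_zero hW hA hne hβ hzH hzA hzβ hS).mono fun u hu ↦ (hset.1 hu).1
    · exact (hasDerivAt_imageFlowC hW hA hne hβ hzH hzA hzβ ⟨hpos, htI.2⟩).hasDerivWithinAt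
  · have htI := hset.1 ⟨ht0, htS⟩
    rw [imageDriverC_toNNReal ⟨htI.1, htI.2.le⟩]
    intro h0
    have := im_imageFlowC_sub_pos hW hA hne hβ hzH hzA hzβ ⟨htI.1, htI.2.le⟩
    rw [h0, sub_self, zero_im] at this
    exact lt_irrefl _ this

include hW hA hne hβ hzH hzA hzβ in
/-- **The image maps are the Loewner maps of the image driving function in capacity time**:
`Loewner.map (W̃ ∘ τ) q (g̃_0 ζ) = g̃_{τ q}(ζ)` for `0 ≤ q < σβ` ([LSW] §5: "`g̃_t` … the Loewner
chain"; Lawler's Prop. 4.41). With `W 0 = 0`: `g̃_0 = E_A` (`imageFlow_zero`), so the Loewner map of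
`W̃ ∘ τ` at capacity time `σ t` sends `Φ_A(z)` to `g̃_t(Φ_A z) = h_t(g_t z) + L_A`.
[cite: LawlerSchrammWerner2003Restriction, §5 (g̃_t = h_t ∘ g_t ∘ Φ_A⁻¹ is a Loewner chain); Lawler2005, Prop. 4.41] -/
theorem map_imageDriverC_eq {q : ℝ≥0} (hq : (q : ℝ) < imageClock W A β) :
    map (imageDriverC W A β) q (imageFlow W A 0 z) = imageFlowC W A β z q := by
  have h := isSolution_imageFlowC hW hA hne hβ hzH hzA hzβ
  have hS0 : 0 ≤ imageClock W A β := (imageClock_mem hW hA hne hβ ⟨β.coe_nonneg, le_rfl⟩).1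
  have hq' : (q : WithTop ℝ≥0) < ((imageClock W A β).toNNReal : WithTop ℝ≥0) :=
    WithTop.coe_lt_coe.2 (by rw [← NNReal.coe_lt_coe, Real.coe_toNNReal _ hS0]; exact hq)
  exact map_eq_of_isSolution (continuous_imageDriverC hW hA hne hβ) h hq'

include hW hA hne hβ hzH hzA hzβ in
/-- **Lifetime lower bound**: the image point `g̃_0(ζ)` of a point `z` alive at `β` is alive under
`W̃ ∘ τ` at least until the image horizon `σ β`. [folklore] -/
theorem le_swallowingTime_imageDriverC :
    ((imageClock W A β).toNNReal : WithTop ℝ≥0) ≤ swallowingTime (imageDriverC W A β) (imageFlow W A 0 z) :=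
  (isSolution_imageFlowC hW hA hne hβ hzH hzA hzβ).le_swallowingTime

include hW hA hne hβ hzH hzA hzβ in
/-- The image point lies in the Loewner domain of `W̃ ∘ τ` at every capacity time `q < σ β`.
[folklore] -/
theorem imageFlow_zero_mem_domain {q : ℝ≥0} (hq : (q : ℝ) < imageClock W A β)
    (h0 : 0 < (imageFlow W A 0 z).im) : imageFlow W A 0 z ∈ domain (imageDriverC W A β) q := by
  refine (mem_domain_iff _ q _).2 ⟨h0, lt_of_lt_of_le ?_ (le_swallowingTime_imageDriverC hW hA hne hβ hzH hzA hzβ)⟩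
  have hS0 : 0 ≤ imageClock W A β := (imageClock_mem hW hA hne hβ ⟨β.coe_nonneg, le_rfl⟩).1
  exact WithTop.coe_lt_coe.2 (by rw [← NNReal.coe_lt_coe, Real.coe_toNNReal _ hS0]; exact hq)

end Chain

end Loewner

end Literature.Probability.RandomPlanarGeometry

end
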